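import Summits.AnomalousDissipation.AnomalousDissipation.Theses.WazewskiBlock
import Summits.AnomalousDissipation.AnomalousDissipation.Theorems.WazewskiBlockPlanarGalerkinNoTrapCoeffODE
import Literature.Analysis.FluidPDE.CheskidovAssemblyTools

/-!
# The landing decl of the line `SketchIdeator1` is EQUIVALENT to the crux
# (crux stmt-AnomalousDissipation-10352, `WazewskiBlock.UniformGalerkinTrap`)

Both idea cards of the crux (`capped-window-index-continuation`, `frozen-faces-coherent-structures`; and, in round 1 of
ideator 2, `rybakowski-ladder`) land on the statement `WindowInvariantSets` of the lead's skeleton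
`Cruxes/UniformGalerkinTrap/Lines/SketchIdeator1.lean`: for every `0 < ν ≤ ν₀` there are `G`, `N₀` such that every level
`N ≥ N₀` carries a nonempty set of Galerkin modes of order `N`, forward invariant under the tree's Galerkin semiflow
`Torus.galerkinFlow ν f N`, inside the window `{kineticEnergy ≤ E} ∩ {(f,·) ≥ ε₀} ∩ {eGradNormSq ≤ G}`.  The sketch proves
`WindowInvariantSets → UniformGalerkinTrap`.  This definition-free support file proves the converse and hence the
EQUIVALENCE (`uniformGalerkinTrap_iff_windowInvariantSets`, with `WindowInvariantSets` unfolded verbatim): the forward orbit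
`U '' [0,∞)` of a trapped trajectory is such a set, because the crux's clause block DETERMINES the orbit:

* `eq_galerkinFlow_of_isGalerkinTrajectory` — field-level uniqueness `U t = Torus.galerkinFlow ν f N t (U 0)` (`t ≥ 0`), from the
  landed "clause block ⇒ coefficient ODE" theorem `WazewskiBlock.PlanarGalerkinNoTrap.isGalerkinTrajectory_coeff`
  (`Theorems/WazewskiBlockPlanarGalerkinNoTrapCoeffODE.lean`) and the tree's uniqueness for the Galerkin ODE
  (`IsGalerkinODESolution.galerkinCoeffFlow_eq`);
* `apply_add_eq_galerkinFlow_of_isGalerkinTrajectory` — semigroup form `U (t + τ) = Torus.galerkinFlow ν f N t (U τ)`;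
* `uniformGalerkinTrap_iff_windowInvariantSets`.

Consequence recorded for the planners (lead's census): the shared landing of the cards is a REFORMULATION of the crux
(semiflow language instead of the clause block), not a weakening; a line makes progress on 10352 only through what it
feeds INTO `WindowInvariantSets`.

References: Robinson–Rodrigo–Sadowski 2016 §4.1, Thm 4.4 Step 1; Constantin–Foias 1988 Ch. 8 (8.5)–(8.6) (uniqueness
of the Galerkin system).
-/

noncomputable section

-- `Summit.<Summit>.<Problem>` is the tree's mandated summit-side namespace (CONVENTIONS §2); deliberate duplicate.
set_option linter.dupNamespace false

open MeasureTheory Set Filter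
open scoped ENNReal NNReal InnerProductSpace

namespace Summit.AnomalousDissipation.AnomalousDissipation.Theorems.UniformGalerkinTrap

open Literature.Analysis.FunctionSpaces Literature.Analysis.FunctionSpaces.Torus
open Literature.Analysis.FluidPDE
open Summit.AnomalousDissipation.AnomalousDissipation.Theorems.WazewskiBlock.PlanarGalerkinNoTrap
  (isGalerkinTrajectory_coeff)

variable {d : Type*} [Fintype d] [DecidableEq d] {ν : ℝ} {N : ℕ}
  {f : UnitAddTorus d → EuclideanSpace ℝ d} {U : ℝ → UnitAddTorus d → EuclideanSpace ℝ d}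

/-- **Field-level uniqueness for the Galerkin semiflow.** A Galerkin trajectory of order `N` with steady force
`f ∈ L²` (the four clauses of `Torus.IsGalerkinTrajectory`) is the orbit of its initial slice:
`U t = Torus.galerkinFlow ν f N t (U 0)` for `t ≥ 0`.  Proof: its Fourier coefficients solve the Galerkin ODE
(`isGalerkinTrajectory_coeff`), so they are the coefficient-semiflow orbit by uniqueness
(`IsGalerkinODESolution.galerkinCoeffFlow_eq`), and both fields are the synthesis of these coefficients
(`IsGalerkinMode.galerkinFlow_eq`, `IsGalerkinMode.realTrigPoly_fourierRestrict`). [folklore] -/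
theorem eq_galerkinFlow_of_isGalerkinTrajectory (h : Torus.IsGalerkinTrajectory ν f N U) (hf : MemLp f 2 volume)
    {t : ℝ} (ht : 0 ≤ t) : U t = Torus.galerkinFlow ν f N t (U 0) := by
  have hcoeff := ((isGalerkinTrajectory_coeff h hf).isGalerkinODESolution).galerkinCoeffFlow_eq ht
  rw [(h.isGalerkinMode 0 le_rfl).galerkinFlow_eq t, hcoeff, max_eq_left ht,
    (h.isGalerkinMode t ht).realTrigPoly_fourierRestrict]

/-- **Semigroup form**: along a Galerkin trajectory with steady force `f ∈ L²`, `U (t + τ) = Torus.galerkinFlow ν f N t (U τ)`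
for `t, τ ≥ 0` (uniqueness applied to the time-shifted trajectory, `Torus.IsGalerkinTrajectory.comp_add_right`). [folklore] -/
theorem apply_add_eq_galerkinFlow_of_isGalerkinTrajectory (h : Torus.IsGalerkinTrajectory ν f N U) (hf : MemLp f 2 volume)
    {t τ : ℝ} (ht : 0 ≤ t) (hτ : 0 ≤ τ) : U (t + τ) = Torus.galerkinFlow ν f N t (U τ) := by
  have h1 := eq_galerkinFlow_of_isGalerkinTrajectory (h.comp_add_right hτ) hf ht
  simpa only [zero_add] using h1

/-- **The crux ⇔ window-invariant sets of the Galerkin semiflow at every large level.**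
Right-hand side = the skeleton's `WindowInvariantSets`, unfolded.  (⇒) the forward orbit `U '' [0,∞)` of a trapped
trajectory is nonempty, consists of Galerkin modes, lies in the window, and is forward invariant because the clause block
forces `U (t + τ) = Torus.galerkinFlow ν f N t (U τ)` (`apply_add_eq_galerkinFlow_of_isGalerkinTrajectory`).  (⇐) any point
of such a set has a trapped forward orbit with the crux's clause block (`IsGalerkinMode.galerkinFlow_clauses`). [folklore] -/
theorem uniformGalerkinTrap_iff_windowInvariantSets :
    Summit.AnomalousDissipation.AnomalousDissipation.Theses.WazewskiBlock.UniformGalerkinTrap ↔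
      ∃ (m : ℕ) (f : UnitAddTorus (Fin 3) → EuclideanSpace ℝ (Fin 3)),
        ((IsSmooth f ∧ IsDivFree f ∧ ∀ k : Fin 3 → ℤ, ((m : ℕ) : ℝ) ^ 2 < freqNormSq k →
          UnitAddTorus.mFourierCoeff (EuclideanSpace.complexify ∘ f) k = 0) ∧ HasZeroMean f) ∧
        ∃ (E ε₀ ν₀ : ℝ), 0 < ε₀ ∧ 0 < ν₀ ∧
          ∀ ν : ℝ, 0 < ν → ν ≤ ν₀ → ∃ (G : ℝ≥0) (N₀ : ℕ), ∀ N : ℕ, N₀ ≤ N →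
            ∃ S : Set (UnitAddTorus (Fin 3) → EuclideanSpace ℝ (Fin 3)), S.Nonempty ∧ (∀ a ∈ S, IsGalerkinMode N a) ∧
              (∀ a ∈ S, ∀ t : ℝ, 0 ≤ t → Torus.galerkinFlow ν f N t a ∈ S) ∧
              S ⊆ {u | kineticEnergy u ≤ E ∧ ε₀ ≤ ∫ x, inner ℝ (f x) (u x) ∧ eGradNormSq u ≤ (G : ℝ≥0∞)} := by
  constructor
  · rintro ⟨m, f, hf, hmean, E, ε₀, ν₀, hε₀, hν₀, h⟩
    refine ⟨m, f, ⟨hf, hmean⟩, E, ε₀, ν₀, hε₀, hν₀, fun ν hν hνle => ?_⟩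
    obtain ⟨G, N₀, hN⟩ := h ν hν hνle
    refine ⟨G, N₀, fun N hN₀ => ?_⟩
    obtain ⟨U, hcl, hwin⟩ := hN N hN₀
    have hf2 : MemLp f 2 volume := hf.1.memLp 2
    have htraj : Torus.IsGalerkinTrajectory ν f N U := Torus.isGalerkinTrajectory_iff.2 hcl
    refine ⟨U '' Ici 0, ⟨U 0, 0, Set.mem_Ici.2 le_rfl, rfl⟩, ?_, ?_, ?_⟩
    · rintro a ⟨τ, hτ, rfl⟩
      exact htraj.isGalerkinMode τ hτ
    · rintro a ⟨τ, hτ, rfl⟩ t ht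
      exact ⟨t + τ, Set.mem_Ici.2 (add_nonneg ht hτ),
        apply_add_eq_galerkinFlow_of_isGalerkinTrajectory htraj hf2 ht hτ⟩
    · rintro a ⟨τ, hτ, rfl⟩
      exact hwin τ hτ
  · rintro ⟨m, f, ⟨hf, hmean⟩, E, ε₀, ν₀, hε₀, hν₀, h⟩
    refine ⟨m, f, hf, hmean, E, ε₀, ν₀, hε₀, hν₀, fun ν hν hνle => ?_⟩
    obtain ⟨G, N₀, hN⟩ := h ν hν hνle
    refine ⟨G, N₀, fun N hN₀ => ?_⟩
    obtain ⟨S, ⟨a, ha⟩, hmode, hinv, hwin⟩ := hN N hN₀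
    have hf2 : MemLp f 2 volume := hf.1.memLp 2
    obtain ⟨-, hcont, hslice, htest, henergy⟩ := (hmode a ha).galerkinFlow_clauses (ν := ν) hν.le hf2
    refine ⟨fun t => Torus.galerkinFlow ν f N t a, ⟨hcont, fun t ht => hslice t ht,
      fun b hb s t hs hst => htest b hb s t hs hst, henergy⟩, fun t ht => ?_⟩
    exact hwin (hinv a ha t ht)

end Summit.AnomalousDissipation.AnomalousDissipation.Theorems.UniformGalerkinTrap

end
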